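import Summits.QuantumFields.YangMills.Theorems.DirichletWindowXiDivergesOfLocalGaussianity
import Summits.QuantumFields.YangMills.Theorems.DirichletWindowAxialLogConvexity
import Literature.Probability.LatticeModels.CorrelationDecay
import HarnessLib

/-!
# The axial correlation length EXISTS in every torus-limit state and DIVERGES for compact simple `G`

Support file for route `DirichletWindow` of `YangMills` (items `XiDiverges` = stmt-QuantumFields-8941,
proved, and `AxialLogConvexity` = stmt-QuantumFields-8940, proved; rung «R2ξ» of LADDER-YM, record axis;
ideator seat ym-idea-4, generation 5, technique card «spectral / trace methods»).  Everything here is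
proved (no `sorry`, no new axiom, no named fact).

## Results

* `axialRateDichotomy` — for EVERY compact group `G`, every continuous unitary matrix representation
  `ρ`, every `β ≥ 0` and every infinite-volume torus-limit state `μ ∈ infiniteVolumeLimitPoints ρ β` of
  four-dimensional Wilson lattice gauge theory, the axial plaquette–plaquette correlation
  `a(n) = f_β(n e₀) = plaquetteCorrFn ρ μ (n e₀)` (Chatterjee's `f_β`, arXiv:1803.01950 Problem 5.1)
  EITHER vanishes identically from separation `2` on, OR is everywhere positive and has an inverse
  correlation length `m ≥ 0` along the axis in the junk-free sense of the StatMech interface,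
  `HasInvCorrLength (plaquetteCorrFn ρ μ) m` (`−log a(n)/n → m`, Friedli–Velenik §3.10.7), together with
  the a-priori envelope `a(n) ≤ a(1) e^{−m(n−1)}` (`n ≥ 1`).
* `axialCorrLengthDiverges` — for every compact SIMPLE `G` and every lattice representation `r`: for
  every `ε > 0` there is `β₁` such that for all `β ≥ β₁` EVERY torus-limit state has `a(n) > 0` for all
  `n` and an axial inverse correlation length `m = ξ(β, μ)⁻¹ ∈ [0, ε]`.  In words: Chatterjee's
  correlation length `ξ(β, μ)` is WELL-DEFINED along the lattice axis in every torus-limit state and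
  `ξ(β, μ) ≥ 1/ε → ∞` uniformly in the state — the second half of Problem 5.1 INCLUDING the existence
  of `ξ` (along the axis), for all compact simple gauge groups.  It is the positive mirror of the
  catalogued barrier theorem `Literature.Barriers.QuantumFields.zn_not_divergentCorrLength` (a fixed
  `ℤ_n` admits no such divergent `ξ`).

## Mechanism (RP-spectral)

In a torus-limit state the axial correlator is a transfer-matrix moment sequence; the tree's
`AxialLogConvexity.plaquetteCorrFn_axial` (Osterwalder–Seiler reflection positivity in link and site
hyperplanes, odd tori included) gives `0 ≤ a`, `a` non-increasing and `a(n+2)² ≤ a(n+1) a(n+3)`.  For a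
positive log-convex non-increasing sequence the slopes `s(k) = log a(k) − log a(k+1)` (`k ≥ 1`) are
`≥ 0` and non-increasing, hence converge to `m = inf s ≥ 0` — the bottom of the support of the
Källén–Lehmann measure in the plaquette channel — and `−log a(n)/n → m` by Cesàro (`slopeLimit`);
zeros propagate (`positivityDichotomy`).  At large `β` the PROVED `XiDiverges` (`xiDiverges_proof`:
`A e^{−m' n} ≤ a(n)`, `A > 0`, `m' ≤ ε`) excludes the vanishing branch and forces `m ≤ m' ≤ ε`
(`rateLeOfLowerBound`).

HONEST FRAMING.  NOT the mass gap: `m = 0` (`ξ = ∞`) is not excluded — positivity of `m` at large `β`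
is Chatterjee's Problem 5.1(a) / the lattice gap (`DirichletWindow.LatticeGapLargeBeta`).  No statement
about off-axis directions (the Euclidean-isotropic rate clause of
`Literature.MathematicalPhysics.QuantumFieldTheory.LatticeMassGapAllCouplings` is not touched).  No
summit is proved by this file.

References: K. Osterwalder, E. Seiler, Ann. Phys. 110 (1978) 440, §2; E. Seiler, LNP 159 (1982) Ch. 2;
S. Friedli, Y. Velenik, *Statistical Mechanics of Lattice Systems* (CUP 2017) §3.10.7;
S. Chatterjee, arXiv:1803.01950, Problem 5.1; I. Montvay, G. Münster, *Quantum Fields on a Lattice*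
(CUP 1994) §3.7.
-/

noncomputable section

open MeasureTheory Filter Topology Finset
open Literature.MathematicalPhysics.QuantumFieldTheory Literature.MathematicalPhysics.QuantumLattice
open Literature.Probability.LatticeModels (Site HasInvCorrLength)

namespace Summit.QuantumFields.YangMills.Theorems.AxialCorrLength

/-! ### Three elementary facts about log-convex sequences -/

/-- Dichotomy: a non-negative, non-increasing sequence that is log-convex from index `1` on either
vanishes from index `2` on or is everywhere positive (zeros of a log-convex sequence propagate).
[folklore] -/
theorem positivityDichotomy (a : ℕ → ℝ) (h0 : ∀ n, 0 ≤ a n) (hanti : ∀ n, a (n + 1) ≤ a n)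
    (hlc : ∀ n, a (n + 2) ^ 2 ≤ a (n + 1) * a (n + 3)) :
    (∀ n, 2 ≤ n → a n = 0) ∨ (∀ n, 0 < a n) := by
  by_cases h2 : a 2 = 0
  · left
    intro n hn
    have hmono : Antitone a := antitone_nat_of_succ_le hanti
    exact le_antisymm (h2 ▸ hmono hn) (h0 n)
  · right
    have h2pos : 0 < a 2 := lt_of_le_of_ne (h0 2) (Ne.symm h2)
    have key : ∀ k, 0 < a (k + 1) ∧ 0 < a (k + 2) := by
      intro k
      induction k with
      | zero => exact ⟨lt_of_lt_of_le h2pos (hanti 1), h2pos⟩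
      | succ k ih =>
        refine ⟨ih.2, ?_⟩
        have hsq : 0 < a (k + 2) ^ 2 := pow_pos ih.2 2
        have hprod : 0 < a (k + 1) * a (k + 3) := lt_of_lt_of_le hsq (hlc k)
        exact (mul_pos_iff_of_pos_left ih.1).1 hprod
    intro n
    cases n with
    | zero => exact lt_of_lt_of_le (key 0).1 (hanti 0)
    | succ n => exact (key n).1

/-- Rate comparison: an exponential LOWER bound `A e^{−m' n} ≤ a(n)`, `A > 0`, forces the limiting rate
`m = lim −log a(n)/n` to satisfy `m ≤ m'`. [folklore] -/
theorem rateLeOfLowerBound (a : ℕ → ℝ) (A m' m : ℝ) (hA : 0 < A)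
    (hlow : ∀ n : ℕ, A * Real.exp (-(m' * n)) ≤ a n)
    (hlim : Tendsto (fun n : ℕ => -Real.log (a n) / n) atTop (𝓝 m)) : m ≤ m' := by
  have hg : Tendsto (fun n : ℕ => m' - Real.log A / n) atTop (𝓝 m') := by
    simpa using tendsto_const_nhds.sub (tendsto_const_div_atTop_nhds_zero_nat (Real.log A))
  refine le_of_tendsto_of_tendsto hlim hg ?_
  filter_upwards [eventually_ge_atTop 1] with n hn
  have hpos : 0 < A * Real.exp (-(m' * n)) := mul_pos hA (Real.exp_pos _)
  have hlog : Real.log A + (-(m' * n)) ≤ Real.log (a n) := by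
    have := Real.log_le_log hpos (hlow n)
    rwa [Real.log_mul hA.ne' (Real.exp_pos _).ne', Real.log_exp] at this
  have hn' : (0:ℝ) < n := by exact_mod_cast hn
  rw [div_le_iff₀ hn', sub_mul, div_mul_cancel₀ _ hn'.ne']
  linarith

/-- Slope limit (the spectral content): for a positive, non-increasing sequence that is log-convex from
index `1` on, `−log a(n)/n` converges to some `m ≥ 0` and `a(n) ≤ a(1) e^{−m(n−1)}` for `n ≥ 1`.  The
slopes `s(k) = log a(k+1) − log a(k+2)` are non-negative and non-increasing, so converge to `m = inf s`;
telescoping and Cesàro give `−log a(n)/n → m`; `s ≥ m` gives the envelope. [folklore] -/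
theorem slopeLimit (a : ℕ → ℝ) (hpos : ∀ n, 0 < a n) (hanti : ∀ n, a (n + 1) ≤ a n)
    (hlc : ∀ n, a (n + 2) ^ 2 ≤ a (n + 1) * a (n + 3)) :
    ∃ m : ℝ, 0 ≤ m ∧ Tendsto (fun n : ℕ => -Real.log (a n) / n) atTop (𝓝 m) ∧
      ∀ n : ℕ, 1 ≤ n → a n ≤ a 1 * Real.exp (-(m * ((n : ℝ) - 1))) := by
  set s : ℕ → ℝ := fun k => Real.log (a (k + 1)) - Real.log (a (k + 2)) with hs
  have hs0 : ∀ k, 0 ≤ s k := fun k =>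
    sub_nonneg.2 (Real.log_le_log (hpos _) (hanti (k + 1)))
  have hsanti : Antitone s := by
    refine antitone_nat_of_succ_le fun k => ?_
    have h := Real.log_le_log (pow_pos (hpos (k + 2)) 2) (hlc k)
    rw [Real.log_pow, Real.log_mul (hpos _).ne' (hpos _).ne'] at h
    push_cast at h
    show Real.log (a (k + 2)) - Real.log (a (k + 3)) ≤ Real.log (a (k + 1)) - Real.log (a (k + 2))
    linarith
  have hbdd : BddBelow (Set.range s) := ⟨0, by rintro _ ⟨k, rfl⟩; exact hs0 k⟩
  set m : ℝ := ⨅ k, s k with hm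
  have hm0 : 0 ≤ m := le_ciInf hs0
  have hms : ∀ k, m ≤ s k := fun k => ciInf_le hbdd k
  have hslim : Tendsto s atTop (𝓝 m) := tendsto_atTop_ciInf hsanti hbdd
  have htel : ∀ n, ∑ k ∈ Finset.range n, s k = Real.log (a 1) - Real.log (a (n + 1)) := by
    intro n
    have := Finset.sum_range_sub' (fun i => Real.log (a (i + 1))) n
    simpa [hs] using this
  have hces : Tendsto (fun n : ℕ => (n⁻¹ : ℝ) * ∑ k ∈ Finset.range n, s k) atTop (𝓝 m) :=
    hslim.cesaro
  have h1 : Tendsto (fun n : ℕ => -Real.log (a (n + 1)) / n) atTop (𝓝 m) := by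
    have hc : Tendsto (fun n : ℕ => Real.log (a 1) / n) atTop (𝓝 0) :=
      tendsto_const_div_atTop_nhds_zero_nat _
    have := hces.sub hc
    rw [sub_zero] at this
    refine this.congr' ?_
    filter_upwards [eventually_ge_atTop 1] with n hn
    have hn' : (n : ℝ) ≠ 0 := by positivity
    rw [htel n]
    field_simp
    ring
  have h2 : Tendsto (fun n : ℕ => -Real.log (a (n + 1)) / ((n + 1 : ℕ) : ℝ)) atTop (𝓝 m) := by
    have hratio : Tendsto (fun n : ℕ => (n : ℝ) / ((n : ℝ) + 1)) atTop (𝓝 1) :=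
      tendsto_natCast_div_add_atTop 1
    have := h1.mul hratio
    rw [mul_one] at this
    refine this.congr' ?_
    filter_upwards [eventually_ge_atTop 1] with n hn
    have hn' : (n : ℝ) ≠ 0 := by positivity
    push_cast
    field_simp
  have hlim : Tendsto (fun n : ℕ => -Real.log (a n) / n) atTop (𝓝 m) :=
    (tendsto_add_atTop_iff_nat 1).1 h2
  refine ⟨m, hm0, hlim, fun n hn => ?_⟩
  obtain ⟨j, rfl⟩ : ∃ j, n = j + 1 := ⟨n - 1, by omega⟩
  have hsum : (j : ℝ) * m ≤ ∑ k ∈ Finset.range j, s k := by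
    have := Finset.sum_le_sum fun k (_ : k ∈ Finset.range j) => hms k
    simpa using this
  have hlog : Real.log (a (j + 1)) = Real.log (a 1) - ∑ k ∈ Finset.range j, s k := by
    rw [htel j]; ring
  have hle : Real.log (a (j + 1)) ≤ Real.log (a 1) - m * (((j + 1 : ℕ) : ℝ) - 1) := by
    rw [hlog]; push_cast; nlinarith [hsum]
  calc a (j + 1) = Real.exp (Real.log (a (j + 1))) := (Real.exp_log (hpos _)).symm
    _ ≤ Real.exp (Real.log (a 1) - m * (((j + 1 : ℕ) : ℝ) - 1)) := Real.exp_le_exp.2 hle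
    _ = a 1 * Real.exp (-(m * (((j + 1 : ℕ) : ℝ) - 1))) := by
        rw [sub_eq_add_neg, Real.exp_add, Real.exp_log (hpos 1)]

/-! ### The lattice statements -/

/-- `HasInvCorrLength` for an axially non-negative function is the plain statement `−log a(n)/n → m`
(the absolute value in the definition is inert). [folklore] -/
theorem hasInvCorrLength_of_tendsto {f : Site 4 → ℝ} {m : ℝ}
    (h0 : ∀ n : ℕ, 0 ≤ f ((n : ℤ) • Pi.single (0 : Fin 4) (1 : ℤ)))
    (h : Tendsto (fun n : ℕ => -Real.log (f ((n : ℤ) • Pi.single (0 : Fin 4) (1 : ℤ))) / n)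
      atTop (𝓝 m)) :
    HasInvCorrLength f m := by
  unfold HasInvCorrLength
  refine h.congr' (Eventually.of_forall fun n => ?_)
  simp only [abs_of_nonneg (h0 n)]

/-- **Theorem (every compact `G`, every `β ≥ 0`, every torus-limit state): the axial plaquette–plaquette
correlation either vanishes identically from separation `2` on, or is everywhere positive with a
well-defined axial inverse correlation length `m ≥ 0` (`HasInvCorrLength`) and the envelope
`f_β(n e₀) ≤ f_β(e₀) e^{−m(n−1)}`.**  Reflection positivity (`AxialLogConvexity.plaquetteCorrFn_axial`)
plus `positivityDichotomy` and `slopeLimit`. [cite: OsterwalderSeiler1978, §2] [cite: FriedliVelenik2017, §3.10.7] -/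
theorem axialRateDichotomy :
  ∀ (G : Type) [Group G] [TopologicalSpace G] [IsTopologicalGroup G] [CompactSpace G]
    [MeasurableSpace G] [BorelSpace G] (N : ℕ) (ρ : G →* Matrix (Fin N) (Fin N) ℂ), Continuous ρ →
    ∀ β : ℝ, 0 ≤ β → ∀ μ ∈ infiniteVolumeLimitPoints (d := 4) ρ β,
      (∀ n : ℕ, 2 ≤ n → plaquetteCorrFn ρ μ ((n : ℤ) • Pi.single (0 : Fin 4) (1 : ℤ)) = 0) ∨
      ((∀ n : ℕ, 0 < plaquetteCorrFn ρ μ ((n : ℤ) • Pi.single (0 : Fin 4) (1 : ℤ))) ∧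
        ∃ m : ℝ, 0 ≤ m ∧ HasInvCorrLength (plaquetteCorrFn ρ μ) m ∧
          ∀ n : ℕ, 1 ≤ n → plaquetteCorrFn ρ μ ((n : ℤ) • Pi.single (0 : Fin 4) (1 : ℤ)) ≤
            plaquetteCorrFn ρ μ (Pi.single (0 : Fin 4) (1 : ℤ)) * Real.exp (-(m * ((n : ℝ) - 1)))) := by
  intro G _ _ _ _ _ _ N ρ hρ β hβ μ hμ
  set a : ℕ → ℝ := fun n => plaquetteCorrFn ρ μ ((n : ℤ) • Pi.single (0 : Fin 4) (1 : ℤ)) with ha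
  have hax := fun n => AxialLogConvexity.plaquetteCorrFn_axial ρ hρ hβ hμ n
  have hnn : ∀ n, 0 ≤ a n := fun n => (hax n).1
  have hanti : ∀ n, a (n + 1) ≤ a n := fun n => (hax n).2.1
  have hlc : ∀ n, a (n + 2) ^ 2 ≤ a (n + 1) * a (n + 3) := fun n => (hax n).2.2.2
  rcases positivityDichotomy a hnn hanti hlc with hzero | hpos
  · exact Or.inl hzero
  · refine Or.inr ⟨hpos, ?_⟩
    obtain ⟨m, hm0, hlim, henv⟩ := slopeLimit a hpos hanti hlc
    refine ⟨m, hm0, hasInvCorrLength_of_tendsto hnn hlim, fun n hn => ?_⟩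
    have := henv n hn
    simpa [ha] using this

/-- **Theorem (compact simple `G`, large `β`): Chatterjee's correlation length exists along the axis in
every torus-limit state and diverges, `ξ(β, μ) = 1/m ≥ 1/ε` for `β ≥ β₁(ε)`, uniformly in the state**
(Problem 5.1, second half, ALONG THE AXIS and INCLUDING the existence of `ξ`).  From the PROVED route
item `XiDiverges` (`xiDiverges_proof`), reflection positivity (`AxialLogConvexity.plaquetteCorrFn_axial`),
`slopeLimit` and `rateLeOfLowerBound`.  The positive mirror of
`Literature.Barriers.QuantumFields.zn_not_divergentCorrLength`.  NOT THE GAP (`m = 0` allowed); no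
summit is proved. [cite: arXiv180301950, §5 Problem 5.1 (second half)] [cite: OsterwalderSeiler1978, §2] -/
theorem axialCorrLengthDiverges :
  ∀ (G : Type) [Group G] [TopologicalSpace G] [IsTopologicalGroup G] [CompactSpace G]
    [MeasurableSpace G] [BorelSpace G], IsCompactSimpleLieGroup G → ∀ r : LatticeRep G,
    ∀ ε : ℝ, 0 < ε → ∃ β₁ : ℝ, ∀ β : ℝ, β₁ ≤ β → ∀ μ ∈ infiniteVolumeLimitPoints (d := 4) r.ρ β,
      (∀ n : ℕ, 0 < plaquetteCorrFn r.ρ μ ((n : ℤ) • Pi.single (0 : Fin 4) (1 : ℤ))) ∧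
      ∃ m : ℝ, 0 ≤ m ∧ m ≤ ε ∧ HasInvCorrLength (plaquetteCorrFn r.ρ μ) m ∧
        ∀ n : ℕ, 1 ≤ n → plaquetteCorrFn r.ρ μ ((n : ℤ) • Pi.single (0 : Fin 4) (1 : ℤ)) ≤
          plaquetteCorrFn r.ρ μ (Pi.single (0 : Fin 4) (1 : ℤ)) * Real.exp (-(m * ((n : ℝ) - 1))) := by
  intro G _ _ _ _ _ _ hG r ε hε
  obtain ⟨β₁, hβ₁⟩ := xiDiverges_proof G hG r ε hε
  refine ⟨max β₁ 0, fun β hβ μ hμ => ?_⟩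
  have hβ1 : β₁ ≤ β := le_trans (le_max_left _ _) hβ
  have hβ0 : 0 ≤ β := le_trans (le_max_right _ _) hβ
  obtain ⟨m', A, hA, hm'0, hm'ε, hlow⟩ := hβ₁ β hβ1 μ hμ
  set a : ℕ → ℝ := fun n => plaquetteCorrFn r.ρ μ ((n : ℤ) • Pi.single (0 : Fin 4) (1 : ℤ)) with ha
  have hax := fun n => AxialLogConvexity.plaquetteCorrFn_axial r.ρ r.continuous hβ0 hμ n
  have hnn : ∀ n, 0 ≤ a n := fun n => (hax n).1
  have hanti : ∀ n, a (n + 1) ≤ a n := fun n => (hax n).2.1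
  have hlc : ∀ n, a (n + 2) ^ 2 ≤ a (n + 1) * a (n + 3) := fun n => (hax n).2.2.2
  have hpos : ∀ n, 0 < a n := fun n =>
    lt_of_lt_of_le (mul_pos hA (Real.exp_pos _)) (hlow n)
  obtain ⟨m, hm0, hlim, henv⟩ := slopeLimit a hpos hanti hlc
  have hmle : m ≤ m' := rateLeOfLowerBound a A m' m hA hlow hlim
  refine ⟨hpos, m, hm0, hmle.trans hm'ε, hasInvCorrLength_of_tendsto hnn hlim, fun n hn => ?_⟩
  have := henv n hn
  simpa [ha] using this

/-- Corollary in the barrier theorem's own shape, NEGATED for compact simple `G`: there IS a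
correlation-length assignment `ξ(β, μ)` which beyond some coupling is positive-or-infinite in the sense
`m = ξ⁻¹ ∈ [0, ∞)`, is the axial inverse decay rate of an everywhere-positive plaquette–plaquette
correlation in every torus-limit state, and diverges (`m(β, μ) → 0` uniformly).  Packaged as the
existence of the RATE function `m`. [cite: arXiv180301950, §5 Problem 5.1 (second half)] -/
theorem exists_axialRate_tendsto_zero (G : Type) [Group G] [TopologicalSpace G] [IsTopologicalGroup G]
    [CompactSpace G] [MeasurableSpace G] [BorelSpace G] (hG : IsCompactSimpleLieGroup G)
    (r : LatticeRep G) :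
    ∃ m : ℝ → Measure (LGConfig 4 G) → ℝ, ∃ β₀ : ℝ,
      (∀ β : ℝ, β₀ ≤ β → ∀ μ ∈ infiniteVolumeLimitPoints (d := 4) r.ρ β,
          0 ≤ m β μ ∧ (∀ n : ℕ, 0 < plaquetteCorrFn r.ρ μ ((n : ℤ) • Pi.single (0 : Fin 4) (1 : ℤ))) ∧
          HasInvCorrLength (plaquetteCorrFn r.ρ μ) (m β μ)) ∧
      ∀ ε : ℝ, 0 < ε → ∃ β₁ : ℝ, ∀ β : ℝ, β₁ ≤ β →
        ∀ μ ∈ infiniteVolumeLimitPoints (d := 4) r.ρ β, m β μ ≤ ε := by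
  classical
  have H := axialCorrLengthDiverges G hG r
  obtain ⟨β₀, hβ₀⟩ := H 1 one_pos
  -- the rate: the limit given by `H 1` where available, else `0`
  let m : ℝ → Measure (LGConfig 4 G) → ℝ := fun β μ =>
    if h : β₀ ≤ β ∧ μ ∈ infiniteVolumeLimitPoints (d := 4) r.ρ β then
      Classical.choose (hβ₀ β h.1 μ h.2).2 else 0
  have hm : ∀ β, β₀ ≤ β → ∀ μ ∈ infiniteVolumeLimitPoints (d := 4) r.ρ β,
      0 ≤ m β μ ∧ HasInvCorrLength (plaquetteCorrFn r.ρ μ) (m β μ) := by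
    intro β hβ μ hμ
    have hspec := Classical.choose_spec (hβ₀ β hβ μ hμ).2
    simp only [m, dif_pos (And.intro hβ hμ)]
    exact ⟨hspec.1, hspec.2.2.1⟩
  refine ⟨m, β₀, fun β hβ μ hμ => ⟨(hm β hβ μ hμ).1, (hβ₀ β hβ μ hμ).1, (hm β hβ μ hμ).2⟩, ?_⟩
  intro ε hε
  obtain ⟨β₁, hβ₁⟩ := H ε hε
  refine ⟨max β₀ β₁, fun β hβ μ hμ => ?_⟩
  have hb0 : β₀ ≤ β := le_trans (le_max_left _ _) hβ
  have hb1 : β₁ ≤ β := le_trans (le_max_right _ _) hβ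
  obtain ⟨-, m₁, -, hm₁ε, hlim₁, -⟩ := hβ₁ β hb1 μ hμ
  have hlim := (hm β hb0 μ hμ).2
  -- uniqueness of limits
  have : m β μ = m₁ := tendsto_nhds_unique hlim hlim₁
  rw [this]; exact hm₁ε

end Summit.QuantumFields.YangMills.Theorems.AxialCorrLength

end
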